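import Summits.BirchSwinnertonDyer.BirchSwinnertonDyer.Theorems.PrintCf2DisegniPairTwoChiLinePointwiseOdd
import Literature.NumberTheory.EllipticCurves.PAdicLFunctionMinusBranchInterpolationProofs
import Literature.NumberTheory.EllipticCurves.PAdicLFunctionMinusConstantTermAtTwoProofs
import Literature.NumberTheory.EllipticCurves.PAdicLFunctionMinusDenominatorsProofs
import Literature.NumberTheory.EllipticCurves.ModularSymbolsManinDrinfeldProofs
import Literature.NumberTheory.EllipticCurves.PAdicLFunctionInterpolationHoldsProofs
import Literature.NumberTheory.EllipticCurves.PAdicLFunctionNeZeroProofs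
import Literature.NumberTheory.EllipticCurves.PAdicPowerSeriesInterpolationAgreementCpProofs
import Literature.NumberTheory.EllipticCurves.PAdicBSDMemIwasawaRatProofs
import HarnessLib

/-!
# Road (C) `disegni-pair-two` on crux stmt-BirchSwinnertonDyer-20368 — the FACTORISATION on the
# `χ₋₄ ∘ N`-line at `p = 2` (`d* = −1`, crux class `D ≡ 3 (mod 4)`): Disegni's `2`-adic Rankin–Selberg
# function is `c⁻ · L₂⁻(E, ω, T) · L₂⁻(E^{(d_K)}, ω, T)` — the ODD branches, SAME variable

Cell `bsd-print-cf2`, width seat `bsd-line-cf2-p1-w8` g21; odd twin of `…ChiLineFactorisation` (`d* = 2`: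
`G(T) = c·L₂(E,−T−2)·L₂(E′,−T−2)`). THEOREMS ONLY (no `def`, no named fact, no `sorry`);
`--supports stmt-BirchSwinnertonDyer-20368`. BSD is not proved by any of this. The planner's PREGRADE §5
factorisation for the twisting character `ε₋₁ = χ₋₄`: here the MTT side is the tree's MINUS
Mazur–Swinnerton-Dyer theory at `2` (`PAdicLFunctionMinus*`: the odd branch
`L₂⁻(g, α, ω, T) = padicLFunctionMinusBranch g α 1`, `ω = χ₋₄` the character of `{±1} ⊂ ℤ₂^×`; its
interpolation `hasSum_padicLMinusBranchCoeff_mul_pow_of_isPrimitive` at an EVEN primitive `κ` of level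
`2^{m+1} ≥ 8` reads the value at the ODD character `κω`; its constant term
`constantCoeff_padicLFunctionMinusBranch_one_two_of_coeffField = α⁻²([1/4]⁻ − [3/4]⁻)`; boundedness
`norm_coeff_padicLFunctionMinusBranch_le` from Manin–Drinfeld), and the points MATCH WITHOUT REFLECTION:
the line point of `θ` (line character `(θχ₄)∘N`) is the MTT point of `κ = χ_θ`.

* `ratMinusTwistedSymbolSum_twin_chi4` — `Σ_{a mod 4} χ_{χ₄}(a)[a/4]⁻_g = ι₂([1/4]⁻_g − [3/4]⁻_g)`;
* `chi4Line_eq_C_mul_map_mul_map` — ★★★ **`G = c⁻ · L₂⁻(E,ω,·)♯ · L₂⁻(E′,ω,·)♯` in `ℂ₂⟦T⟧`**,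
  `c⁻ = ι⁻¹(−u·Car·Ω⁻_f·Ω⁻_{f′})` (`eq_C_mul_map_mul_map_of_forall_hasSum_of_bounded`: constant term
  from `hasLineValueAt_chi4Line_zero`; even primitive characters of level `4` do not exist
  (`not_isPrimitive_of_even_level_four`); level `≥ 8` from `hasLineValueAt_chi4Line_of_two_le` + the
  minus interpolation read through `sum_twin_mul_teichWeight_eq_ratMinusTwistedSymbolSum`);
* `coeff_one_chi4Line_eq_of_constantCoeff_eq_zero` — **if `L₂⁻(E,ω,0) = 0` then
  `[T¹]G = c⁻ · [T¹]L₂⁻(E,ω,T) · L₂⁻(E′,ω,0)`**: the planner's «ord₂ G′_χ(0) = D + a» for `d* = −1`,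
  `D = ord₂[T¹]L₂⁻(E,ω,·)`, `a = ord₂ L₂⁻(E′,ω,0)`.

Setting: `E = V/ℚ` globally minimal GOOD ORDINARY at `2` (newform `f`, `α = unitRoot V 2`), `K` quadratic
with `(2, d_K) = 1`, `2` split (`𝔭, 𝔭′ ∋ 2`), Kronecker character `κ_K`; `V′` globally minimal, good
ordinary at `2`, `a₂(V′) = a₂(V)`, newform `f′` with `a_n(f′) = κ_K(n)a_n(f)`; `G` Disegni's function on
the line through `χ₄∘N_{K/ℚ}` (`Disegni2017.ChiLineInterpolation`). For the crux: `E = 49a1^{(d′)}`,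
`d′ ≡ 1 (4)` (`isOrdinaryAt_two_of_cm7_quadraticTwist`), `W = E ⊗ χ₋₄ = 49a1^{(−d′)}`.

References: [Disegni2017] Thm. A, Lemma 10.2.1–10.2.2; [MazurTateTeitelbaum1986Invent] §I.8 (8.6), §I.10
(10.1)–(10.2), §I.11–I.14; [PerrinRiou1987] (1.1); cell PREGRADE
`bsd-print-cf2-plan/PREGRADE-disegni-pair-two-skeleton-g24.md` §5.
-/

set_option autoImplicit false
set_option linter.dupNamespace false

noncomputable section

open scoped Classical MatrixGroups ModularForm NumberField

open CongruenceSubgroup NumberField IsDedekindDomain WeierstrassCurve Literature.NumberTheory.EllipticCurves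
  Literature.NumberTheory.EllipticCurves.ModularForms
  Literature.NumberTheory.EllipticCurves.Disegni2017 Literature.NumberTheory.GaloisRepresentations
  Summit.BirchSwinnertonDyer.Rank1Residual.Additive

namespace Summit.BirchSwinnertonDyer.BirchSwinnertonDyer.Theorems.PrintCf2.DisegniPairTwo

section FactorisationOdd

variable (ι : PadicAlgCl 2 ≃+* ℂ) (K : Type) [Field K] [NumberField K] [IsGalois ℚ K]

/-- **The minus twisted symbol sum of `χ₄` (through its twin) is `[1/4]⁻_g − [3/4]⁻_g`**:
`Σ_{a mod 4} χ_{χ₄}(a)[a/4]⁻_g = ι₂([1/4]⁻_g − [3/4]⁻_g)` (`χ_{χ₄}(1) = 1`, `χ_{χ₄}(3) = ι⁻¹(−1)⁻¹ = −1`,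
`χ_{χ₄}(0) = χ_{χ₄}(2) = 0`) — the shape of the odd-branch constant term at `2`
(`constantCoeff_padicLFunctionMinusBranch_one_two`). [cite: MazurTateTeitelbaum1986Invent, §I.13–I.14] -/
theorem ratMinusTwistedSymbolSum_twin_chi4 {N : ℕ} (g : CuspForm (Gamma0 N) 2) :
    ratMinusTwistedSymbolSum g
        (((ZMod.χ₄.ringHomComp (Int.castRingHom ℂ) : DirichletCharacter ℂ (2 ^ 2))⁻¹.ringHomComp
          ι.symm.toRingHom).ringHomComp (algebraMap (PadicAlgCl 2) ℂ_[2])) =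
      algebraMap ℚ_[2] ℂ_[2] ((ratMinusSymbol g (1 / 4) : ℚ_[2]) - (ratMinusSymbol g (3 / 4) : ℚ_[2])) := by
  -- the level of the twin is the literal `4` (from `ZMod.χ₄ : MulChar (ZMod 4) ℤ`)
  set ψ := (((ZMod.χ₄.ringHomComp (Int.castRingHom ℂ) : DirichletCharacter ℂ (2 ^ 2))⁻¹.ringHomComp
      ι.symm.toRingHom).ringHomComp (algebraMap (PadicAlgCl 2) ℂ_[2])) with hψ
  -- values of the twin on `ℤ/4 = {0, 1, 2, 3}`
  have hψv : ∀ a : ZMod 4, ψ a = ((ZMod.χ₄ a : ℤ) : ℂ_[2]) := by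
    intro a
    rw [hψ, MulChar.ringHomComp_apply, MulChar.ringHomComp_apply, MulChar.inv_apply_eq_inv',
      MulChar.ringHomComp_apply]
    have hcases : ∀ x : ZMod 4, ZMod.χ₄ x = 0 ∨ ZMod.χ₄ x = 1 ∨ ZMod.χ₄ x = -1 := by decide
    rcases hcases a with h | h | h <;> rw [h] <;> simp
  rw [ratMinusTwistedSymbolSum, Finset.sum_eq_add (1 : ZMod 4) 3 (by decide)]
  · rw [hψv, hψv, show ZMod.χ₄ (1 : ZMod 4) = 1 by decide, show ZMod.χ₄ (3 : ZMod 4) = -1 by decide,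
      show (1 : ZMod 4).val = 1 by decide, show (3 : ZMod 4).val = 3 by decide]
    simp only [Int.cast_one, Int.cast_neg, one_mul, neg_one_mul, map_sub, map_ratCast, Nat.cast_one,
      Nat.cast_ofNat, ← sub_eq_add_neg]
  · intro c _ hc
    have hc' : ∀ x : ZMod 4, x ≠ 1 ∧ x ≠ 3 → ZMod.χ₄ x = 0 := by decide
    rw [hψv, hc' c hc, Int.cast_zero, zero_mul]
  · intro h; exact absurd (Finset.mem_univ _) h
  · intro h; exact absurd (Finset.mem_univ _) h

/-- ★★★ **FACTORISATION of Disegni's `2`-adic Rankin–Selberg function on the `χ₋₄∘N`-line** (`d* = −1`):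
with the notation of the module docstring, **`G = c⁻ · L₂⁻(E,ω,T)♯ · L₂⁻(E′,ω,T)♯`** in `ℂ₂⟦T⟧`,
`L₂⁻(g,ω,T) = padicLFunctionMinusBranch g α 1`, `c⁻ = ι⁻¹(−u·Car·Ω⁻_f·Ω⁻_{f′})`: Disegni's function on
the line through the ODD genus-type character `χ₋₄∘N_{K/ℚ}` is the product of the two ODD-branch
Mazur–Tate–Teitelbaum `2`-adic `L`-functions of `E` and `E^{(d_K)}` in the SAME variable (the line point
of `θ` is the MTT point of `χ_θ`, the line character there being `(θχ₋₄)∘N`). Proof: bounded-interpolant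
uniqueness over `ℂ₂` (`eq_C_mul_map_mul_map_of_forall_hasSum_of_bounded`), the two sides agreeing at
`T = 0` (`hasLineValueAt_chi4Line_zero` vs `constantCoeff_padicLFunctionMinusBranch_one_two_of_coeffField`)
and at every even primitive `2`-power-order `χ` mod `2^{m+2}` (none at level `4`; at level `≥ 8`:
`hasLineValueAt_chi4Line_of_two_le` vs `hasSum_padicLMinusBranchCoeff_mul_pow_of_isPrimitive` read through
`sum_twin_mul_teichWeight_eq_ratMinusTwistedSymbolSum`). [cite: Disegni2017, Theorem A and Lemma 10.2.1–10.2.2 (arXiv v3 PDF pp. 6–8, 68)]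
[cite: MazurTateTeitelbaum1986Invent, §I.10 (10.1)–(10.2), §I.11–I.14 (14.3)] [cite: PerrinRiou1987, (1.1) (p. 459)] -/
theorem chi4Line_eq_C_mul_map_mul_map (h2 : Module.finrank ℚ K = 2)
    (hsplit : ((Ideal.span {(2 : ℤ)}).primesOver (𝓞 K)).ncard = 2)
    (𝔭 𝔭' : HeightOneSpectrum (𝓞 K)) (h𝔭 : ((2 : ℕ) : 𝓞 K) ∈ 𝔭.asIdeal)
    (h𝔭' : ((2 : ℕ) : 𝓞 K) ∈ 𝔭'.asIdeal)
    (κ : DirichletCharacter ℂ (NumberField.discr K).natAbs)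
    (hκ : ∀ ℓ : ℕ, ℓ.Prime → ℓ ≠ 2 → κ ℓ = (jacobiSym (NumberField.discr K) ℓ : ℂ))
    (hκ2 : κ 2 = if NumberField.discr K % 8 = 1 then 1
        else if NumberField.discr K % 8 = 5 then -1 else 0)
    (hd : Nat.Coprime 2 (NumberField.discr K).natAbs)
    (V V' : WeierstrassCurve ℚ) [V.IsElliptic] [V.IsGloballyMinimal] [V'.IsElliptic] [V'.IsGloballyMinimal]
    (hordV : IsOrdinaryAt V 2) (hordV' : IsOrdinaryAt V' 2) (hap : V'.frobeniusTrace 2 = V.frobeniusTrace 2)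
    {N N' : ℕ} [NeZero N] [NeZero N'] {f : CuspForm (Gamma0 N) 2}
    {f' : CuspForm (Gamma0 N') 2} (hfV : IsNewformOf V f) (hfV' : IsNewformOf V' f')
    (hV' : ∀ n : ℕ, cuspCoeff f' n = κ (n : ZMod _) * cuspCoeff f n)
    {Car : ℝ} {G : PowerSeries ℂ_[2]}
    (hG : ChiLineInterpolation ι K f (ι (((unitRoot V 2 : ℚ_[2]) : PadicAlgCl 2)))
      (baseChangeDirichlet K (ZMod.χ₄.ringHomComp (Int.castRingHom ℂ))) 𝔭 𝔭' Car G) :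
    G = PowerSeries.C
          (((ι.symm (-(splitLocalConstant 2 : ℂ) * (Car : ℂ) * (minusPeriod f : ℂ) * (minusPeriod f' : ℂ)) :
              PadicAlgCl 2) : ℂ_[2])) *
        PowerSeries.map (algebraMap ℚ_[2] ℂ_[2])
          (padicLFunctionMinusBranch f (unitRoot V 2 : ℚ_[2]) 1) *
        PowerSeries.map (algebraMap ℚ_[2] ℂ_[2])
          (padicLFunctionMinusBranch f' (unitRoot V 2 : ℚ_[2]) 1) := by
  -- the unit root `α` (common to `V` and `V′`)
  obtain ⟨hαeq, hαu, hα0⟩ := unitRoot_coe_spec (W := V) hordV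
  obtain ⟨hαeq', -, -⟩ := unitRoot_coe_spec (W := V') hordV'
  have hα' : (unitRoot V' 2 : ℚ_[2]) = (unitRoot V 2 : ℚ_[2]) := by
    rw [show unitRoot V' 2 = unitRoot V 2 by unfold unitRoot; rw [hap]]
  rw [hα', hap] at hαeq'
  set α : ℚ_[2] := (unitRoot V 2 : ℚ_[2]) with hαdef
  set c : ℂ_[2] := ((ι.symm (-(splitLocalConstant 2 : ℂ) * (Car : ℂ) * (minusPeriod f : ℂ) *
    (minusPeriod f' : ℂ)) : PadicAlgCl 2) : ℂ_[2]) with hc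
  have hf : IsNewform0 f := hfV.1
  have hQ : coeffField f = ⊥ := hfV.coeffField_eq_bot
  have hf' : IsNewform0 f' := hfV'.1
  have hQ' : coeffField f' = ⊥ := hfV'.coeffField_eq_bot
  have hN : ¬ 2 ∣ N := not_dvd_level_of_isNewformOf hfV hordV.1
  have hN' : ¬ 2 ∣ N' := not_dvd_level_of_isNewformOf hfV' hordV'.1
  have hapf : cuspCoeff f 2 = ((V.frobeniusTrace 2 : ℤ) : ℂ) :=
    cuspCoeff_eq_frobeniusTrace_of_isNewformOf_holds hfV hordV.1
  have hapf' : cuspCoeff f' 2 = ((V.frobeniusTrace 2 : ℤ) : ℂ) := by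
    rw [← hap]; exact cuspCoeff_eq_frobeniusTrace_of_isNewformOf_holds hfV' hordV'.1
  have hαeq2 : α ^ 2 - ((V.frobeniusTrace 2 : ℤ) : ℚ_[2]) * α + 2 = 0 := by exact_mod_cast hαeq
  have hαeq2' : α ^ 2 - ((V.frobeniusTrace 2 : ℤ) : ℚ_[2]) * α + 2 = 0 := by exact_mod_cast hαeq'
  -- the minus Mazur–Swinnerton-Dyer measures of `f`, `f′` are bounded distributions
  have hdist₁ := fun n a ↦
    sum_fiber_msdMinusMeasure_succ_eq_of_coeffField (p := 2) hf hQ hN hapf hα0 hαeq n a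
  have hdist₂ := fun n a ↦
    sum_fiber_msdMinusMeasure_succ_eq_of_coeffField (p := 2) hf' hQ' hN' hapf' hα0 hαeq' n a
  obtain ⟨C₁, hC₁⟩ := exists_norm_msdMinusMeasure_le_of_maninDrinfeld (p := 2)
    (exists_nsmul_modularSymbol_mem_periodLattice_of_isNewform0 hf hQ) hαu
  obtain ⟨C₂, hC₂⟩ := exists_norm_msdMinusMeasure_le_of_maninDrinfeld (p := 2)
    (exists_nsmul_modularSymbol_mem_periodLattice_of_isNewform0 hf' hQ') hαu
  -- boundedness of `G` and of the two odd branches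
  obtain ⟨CG, hCG⟩ := hG.isLineFunction.1
  have hM₁ : MemIwasawaRat 2 (padicLFunctionMinusBranch f α 1) :=
    memIwasawaRat_of_forall_norm_coeff_le (norm_coeff_padicLFunctionMinusBranch_le f α hdist₁ hC₁ 1)
  have hM₂ : MemIwasawaRat 2 (padicLFunctionMinusBranch f' α 1) :=
    memIwasawaRat_of_forall_norm_coeff_le (norm_coeff_padicLFunctionMinusBranch_le f' α hdist₂ hC₂ 1)
  -- (a) the constant term: `G(0) = c⁻ · α⁻²([1/4]⁻_f − [3/4]⁻_f) · α⁻²([1/4]⁻_{f′} − [3/4]⁻_{f′})`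
  have h0 : PowerSeries.constantCoeff G =
      c * algebraMap ℚ_[2] ℂ_[2] (PowerSeries.constantCoeff (padicLFunctionMinusBranch f α 1)) *
        algebraMap ℚ_[2] ℂ_[2] (PowerSeries.constantCoeff (padicLFunctionMinusBranch f' α 1)) := by
    have hG0 := hasLineValueAt_chi4Line_zero ι K h2 hsplit 𝔭 𝔭' h𝔭 h𝔭' κ hκ hκ2 hd hf hQ hf' hQ' hV' α hG
    rw [constantCoeff_padicLFunctionMinusBranch_one_two_of_coeffField f hf hQ hN hapf hα0 hαeq2,
      constantCoeff_padicLFunctionMinusBranch_one_two_of_coeffField f' hf' hQ' hN' hapf' hα0 hαeq2', map_mul,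
      map_mul, ← ratMinusTwistedSymbolSum_twin_chi4 ι f, ← ratMinusTwistedSymbolSum_twin_chi4 ι f']
    exact (HasLineValueAt.eq_constantCoeff hG0).symm
  -- (b) the characters of `Γ` of level `2^{m+2}`: both sides at the twin `χ_θ` of `θ`
  have hchar : ∀ (m : ℕ) (χ : DirichletCharacter ℂ_[2] (2 ^ (m + 2))), χ.IsPrimitive → χ.Even →
      (∃ j : ℕ, orderOf χ = 2 ^ j) → ∀ v₁ v₂ : ℂ_[2],
        HasSum (fun i ↦ algebraMap ℚ_[2] ℂ_[2] (PowerSeries.coeff i (padicLFunctionMinusBranch f α 1)) *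
          (χ (cyclotomicGenerator 2 : ZMod (2 ^ (m + 2))) - 1) ^ i) v₁ →
        HasSum (fun i ↦ algebraMap ℚ_[2] ℂ_[2] (PowerSeries.coeff i (padicLFunctionMinusBranch f' α 1)) *
          (χ (cyclotomicGenerator 2 : ZMod (2 ^ (m + 2))) - 1) ^ i) v₂ →
        HasSum (fun i ↦ PowerSeries.coeff i G *
          (χ (cyclotomicGenerator 2 : ZMod (2 ^ (m + 2))) - 1) ^ i) (c * v₁ * v₂) := by
    intro m χ hχ heven hord v₁ v₂ hv₁ hv₂
    have hfin : IsOfFinOrder χ := by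
      obtain ⟨j, hj⟩ := hord
      exact orderOf_pos_iff.mp (by rw [hj]; exact pow_pos two_pos j)
    obtain ⟨θ, rfl⟩ := exists_eq_twin_of_isOfFinOrder ι χ hfin
    have hθprim : θ.IsPrimitive := (twin_isPrimitive_iff ι θ).mp hχ
    have hθeven : θ.Even := (twin_even_iff ι θ).mp heven
    rcases Nat.eq_zero_or_pos m with hm0 | hmpos
    · -- level `4`: there is no even primitive character
      subst hm0
      exact absurd hθprim (not_isPrimitive_of_even_level_four θ hθeven)
    · -- level `2^{m+2} ≥ 8`: line character `(θχ₄)∘N`, MTT character `χ_θ ω`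
      have hm1 : 2 ≤ m + 1 := by omega
      have he : cyclotomicExponent 2 ≤ m + 1 := by rw [cyclotomicExponent_two]; exact hm1
      have h4 : 4 ∣ 2 ^ (m + 1 + 1) := by
        rw [show (4 : ℕ) = 2 ^ 2 by norm_num]; exact pow_dvd_pow 2 (by omega)
      have hGθ := hasLineValueAt_chi4Line_of_two_le ι K h2 hsplit 𝔭 𝔭' h𝔭 h𝔭' κ hκ hκ2 hd hf hQ hf' hQ'
        hV' α hG hm1 h4 hθeven hθprim
      rw [← twin_apply_cyclotomicGenerator_sub_one ι θ] at hGθ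
      -- the odd-branch interpolation at `χ_θ` (MTT (14.3) at the character `χ_θ ω`)
      have hT₁ := hasSum_padicLMinusBranchCoeff_mul_pow_of_isPrimitive f α hdist₁ hC₁ 1 he _ hχ heven hord
      have hT₂ := hasSum_padicLMinusBranchCoeff_mul_pow_of_isPrimitive f' α hdist₂ hC₂ 1 he _ hχ heven hord
      rw [sum_twin_mul_teichWeight_eq_ratMinusTwistedSymbolSum ι (he.trans (Nat.le_succ _)) h4 θ] at hT₁ hT₂
      simp only [← coeff_padicLFunctionMinusBranch] at hT₁ hT₂
      rw [hv₁.unique hT₁, hv₂.unique hT₂]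
      exact hGθ
  exact eq_C_mul_map_mul_map_of_forall_hasSum_of_bounded hCG hM₁ hM₂ c h0 hchar

/-- ★★ **The rank-one leading coefficient on the `χ₋₄∘N`-line**: if the odd branch of `E` vanishes at
`T = 0` (`L₂⁻(E,ω,0) = α⁻²([1/4]⁻−[3/4]⁻) = 0`, i.e. `L(E⊗χ₋₄, 1) = 0` by Birch's formula — the sign
`−1` of the additive member `W = E ⊗ χ₋₄`), then `[T¹]G = c⁻ · [T¹]L₂⁻(E,ω,T) · L₂⁻(E′,ω,0)` — the
exact form of «ord₂ G′_χ(0) = D + a» for `d* = −1`. [cite: Disegni2017, Theorem A/B (arXiv v3 PDF pp. 6–9)]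
[cite: MazurTateTeitelbaum1986Invent, §I.13–I.14] [cite: PerrinRiou1987, (1.1) (p. 459)] -/
theorem coeff_one_chi4Line_eq_of_constantCoeff_eq_zero (h2 : Module.finrank ℚ K = 2)
    (hsplit : ((Ideal.span {(2 : ℤ)}).primesOver (𝓞 K)).ncard = 2)
    (𝔭 𝔭' : HeightOneSpectrum (𝓞 K)) (h𝔭 : ((2 : ℕ) : 𝓞 K) ∈ 𝔭.asIdeal)
    (h𝔭' : ((2 : ℕ) : 𝓞 K) ∈ 𝔭'.asIdeal)
    (κ : DirichletCharacter ℂ (NumberField.discr K).natAbs)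
    (hκ : ∀ ℓ : ℕ, ℓ.Prime → ℓ ≠ 2 → κ ℓ = (jacobiSym (NumberField.discr K) ℓ : ℂ))
    (hκ2 : κ 2 = if NumberField.discr K % 8 = 1 then 1
        else if NumberField.discr K % 8 = 5 then -1 else 0)
    (hd : Nat.Coprime 2 (NumberField.discr K).natAbs)
    (V V' : WeierstrassCurve ℚ) [V.IsElliptic] [V.IsGloballyMinimal] [V'.IsElliptic] [V'.IsGloballyMinimal]
    (hordV : IsOrdinaryAt V 2) (hordV' : IsOrdinaryAt V' 2) (hap : V'.frobeniusTrace 2 = V.frobeniusTrace 2)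
    {N N' : ℕ} [NeZero N] [NeZero N'] {f : CuspForm (Gamma0 N) 2}
    {f' : CuspForm (Gamma0 N') 2} (hfV : IsNewformOf V f) (hfV' : IsNewformOf V' f')
    (hV' : ∀ n : ℕ, cuspCoeff f' n = κ (n : ZMod _) * cuspCoeff f n)
    {Car : ℝ} {G : PowerSeries ℂ_[2]}
    (hG : ChiLineInterpolation ι K f (ι (((unitRoot V 2 : ℚ_[2]) : PadicAlgCl 2)))
      (baseChangeDirichlet K (ZMod.χ₄.ringHomComp (Int.castRingHom ℂ))) 𝔭 𝔭' Car G)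
    (h0 : PowerSeries.constantCoeff (padicLFunctionMinusBranch f (unitRoot V 2 : ℚ_[2]) 1) = 0) :
    PowerSeries.coeff 1 G =
      ((ι.symm (-(splitLocalConstant 2 : ℂ) * (Car : ℂ) * (minusPeriod f : ℂ) * (minusPeriod f' : ℂ)) :
          PadicAlgCl 2) : ℂ_[2]) *
        algebraMap ℚ_[2] ℂ_[2] (PowerSeries.coeff 1 (padicLFunctionMinusBranch f (unitRoot V 2 : ℚ_[2]) 1)) *
        algebraMap ℚ_[2] ℂ_[2]
          (PowerSeries.constantCoeff (padicLFunctionMinusBranch f' (unitRoot V 2 : ℚ_[2]) 1)) := by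
  have h0' : padicLMinusBranchCoeff f (unitRoot V 2 : ℚ_[2]) 1 0 = 0 := by
    simpa only [constantCoeff_padicLFunctionMinusBranch] using h0
  rw [chi4Line_eq_C_mul_map_mul_map ι K h2 hsplit 𝔭 𝔭' h𝔭 h𝔭' κ hκ hκ2 hd V V' hordV hordV' hap hfV hfV'
    hV' hG, mul_assoc, PowerSeries.coeff_C_mul, PowerSeries.coeff_mul, Finset.Nat.antidiagonal_succ,
    Finset.sum_cons, Finset.Nat.antidiagonal_zero]
  simp [h0', mul_assoc]

end FactorisationOdd

end Summit.BirchSwinnertonDyer.BirchSwinnertonDyer.Theorems.PrintCf2.DisegniPairTwo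

end
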